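import Literature.AlgebraicGeometry.ModuliOfAbelianVarieties.SiegelFamilyShimuraLocusTypeDelta
import Literature.AlgebraicGeometry.ModuliOfAbelianVarieties.SiegelFamilyShimuraLocusGenericResidual
import HarnessLib

/-!
# Shimura's Theorem 2 under condition (5): for a type `δ` with `jΔ = Δj` the generic points of `𝔜_j` carry
# `End(X^δ_Z) = ℤ`, `(X^δ_Z, E^δ_Z) ≅ (X^δ_{−Z̄}, E^δ_{−Z̄})` and no real structure — a residual subset of
# `𝔥_g ∩ 𝔜_j` (Shimura 1972, §3 Thm. 2 «If the polarization satisfies the condition (5)»)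

Topic `Literature/AlgebraicGeometry/ModuliOfAbelianVarieties` (the Siegel-family files, namespace
`Literature.AlgebraicGeometry.ModuliOfAbelianVarieties.SiegelModuli`).  Lane `lit-hodgefound`
(Track 2 foundations library), prover seat p15 generation 50, row g50-#3, on top of g50-#2
(`SiegelFamilyShimuraLocusTypeDelta`: Prop. 10 and Prop. 12 for the Siegel torus OF TYPE `δ`,
`X^δ_Z = ℂ^g/(Z, Δ)ℤ^{2g}`, under `jΔ = Δj`, granted `End(X^δ_Z)^* = {±1}`) and g50-#1
(`SiegelFamilyShimuraLocusGenericResidual`: for the PRINCIPAL torus the points of `𝔥_g ∩ 𝔜_j` with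
`End(X_Z) = ℤ` are residual).  THIS FILE supplies the missing genericity input in type `δ` and assembles
THEOREM 2 in the generality Shimura states it — «If the polarization satisfies the condition (5)»:
(i) `End(X^δ_Z)` in blocks for the period matrix `(Z, Δ)` (Lange's (1.2) `A(Z, D) = (Z, D)R`, both ways);
(ii) **`End(X_Z) = ℤ ⟹ End(X^δ_Z) = ℤ` at the same `Z`** (an integral `R` holomorphic on `X^δ_Z` yields,
after clearing the denominators `DΔ⁻¹`, `D = ∏ δ_i`, an integral matrix holomorphic on the principal
`X_Z`, which is scalar, whence `R` is scalar); (iii) hence the generic points of `𝔥_g ∩ 𝔜_j` — a residual,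
dense subset by g50-#1 — satisfy, for EVERY type `δ` with `jΔ = Δj`: `(X^δ_Z, E^δ_Z) ≅ (X^δ_{−Z̄}, E^δ_{−Z̄})`
as polarized tori of type `δ` with `λ^ρ ∘ λ = −1`, `X^δ_Z ≅` every conjugate presentation, `End(X^δ_Z) = ℤ`,
and `IsEmpty (RealStructure X^δ_Z)`; (iv) AS PRINTED for `δ = (d 0; 0 d)`, `j = j₀ = (0 −1_m; 1_m 0)`.
THEOREMS ONLY: no definition, no instance, no notation, no named fact (net Literature debt `0`), no
`sorry`.

## Source, VERBATIM

G. Shimura, *On the field of rationality for an abelian variety*, Nagoya Math. J. **45** (1972) 167–178,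
held `paper:doi-10-1017-s0027763000014720`, p. 167 «A negative answer similar to (II) will be given also
for abelian varieties with a certain type of polarization which is not necessarily principal», §3
pp. 174–177: «**(5)** Each invariant factor of `δ` occurs with an even multiplicity. … we may assume …
that `δ` itself is of the form `(d 0; 0 d)`.» «**PROPOSITION 10.** Suppose that `δ = (d 0; 0 d)` … for
every `z ∈ 𝔜`, there is an isomorphism `λ` of `P_z` onto `P_z^ρ` such that `λ^ρ ∘ λ = −1`.»
«**PROPOSITION 12.** If `P_z`, with `z ∈ 𝔜`, has no automorphisms other than `±1`, then `P_z` has no model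
rational over its field of moduli.» «**THEOREM 2.** Let `P` be a generic polarized abelian variety of even
dimension.  If the polarization satisfies the condition (5), then `P` has no model rational over its
field of moduli.  Proof. … to prove our theorem, it is sufficient to find a generic `P_z` with `z` in
`𝔜`. … `X_f` is a closed subset of `𝔜`, which contains no non-empty open subset of `𝔜` by Prop. 11.
Since `S′` is a countable set, `𝔜` cannot be covered by `∪_{f ∈ S′} X_f`.  Therefore `𝔜` has a point `z`
for which `f(φ(z)) ≠ 0` for all `f ∈ S′`.  Then `φ(z)` is generic on `V` over `ℚ`, q.e.d.»

H. Lange, *Abelian Varieties over the Complex Numbers* (2023), §1.1.2 Prop. 1.1.6 and (1.2), pp. 19–20: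
«`ρ_a(f) Π = Π′ ρ_r(f)` (1.2)»; §3.1.2, pp. 158–160: «`A(Z′, D) = (Z, D)R`».

## The tree's rendering (`X^δ_Z = ℂ^g/(Z, Δ)ℤ^{2g}`, `Δ = diag(δ)`, `𝔜_j = {Z ∈ 𝔥_g : jZ = −Z̄j}`)

As before «generic» is rendered by the torus-level property used, `End = ℤ` (every integral `R` with
`R_ℝ J = J R_ℝ` is scalar), proved here to be INDEPENDENT OF THE TYPE at a given `Z`.

* **§1 `End(X^δ_Z)` in blocks** (`mul_siegelPeriodMatrix_eq_mul_fromBlocks_iff_of_type`: `A(Z, Δ) = (Z, Δ)R`,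
  `R = (α β; γ δ′)`, iff `AZ = Zα + Δγ` and `AΔ = Zβ + Δδ′`; `exists_blocks_rel_of_mulVec_latticeJ_of_type`
  and its converse `mulVec_latticeJ_comm_of_blocks_rel_of_type`).
* **§2 The type does not matter for `End = ℤ`** (`end_eq_smul_one_of_type_of_principal`: with `D = ∏ δ_i`,
  `Δᶜ = DΔ⁻¹` integral, an integral `R` holomorphic on `X^δ_Z` with analytic representation `A` gives the
  integral `(Dα, βΔᶜ; DΔγ, Δδ′Δᶜ)` holomorphic on the principal `X_Z` with analytic representation `DA`;
  if that is scalar then `β = γ = 0`, `α = δ′ = a·1`).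
* **§3 THEOREM 2 under condition (5)**: at every `Z ∈ 𝔥_g ∩ 𝔜_j` with principal `End(X_Z) = ℤ` and every
  type `δ` with `jΔ = Δj` (`j² = −1`, `ᵗj j = 1`, `g ≥ 1`): `End(X^δ_Z) = ℤ`, `End^* = {±1}`,
  `(X^δ_Z, E^δ_Z) ≅ (X^δ_{−Z̄}, E^δ_{−Z̄})` with `λ^ρ ∘ λ = −1`, `X^δ_Z ≅` every conjugate presentation,
  `IsEmpty (RealStructure X^δ_Z)` (`generic_of_type_of_end_eq_smul_one`); these points are RESIDUAL and dense
  in `𝔥_g ∩ 𝔜_j` and escape every countable union of closed nowhere dense subsets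
  (`eventually_residual_locus_generic_of_type`, `dense_locus_generic_of_type`,
  `exists_locus_generic_not_mem_iUnion_of_type`).
* **§4 AS PRINTED**: `δ = (d, d)`, `j = j₀ = (0 −1_m; 1_m 0)`, `n = 2m ≥ 2`: there are (densely many) `z ∈ 𝔜`
  whose `P_z` of type `(d, d)` has `End = ℤ`, is isomorphic to `P_z^ρ`, and has no model over `ℝ`
  (`exists_locus_generic_typeFive`).
-/

noncomputable section

open scoped Manifold Matrix ComplexConjugate Topology
open Matrix Complex Function Set Filter

namespace Literature.AlgebraicGeometry.ModuliOfAbelianVarieties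

namespace SiegelModuli

open Literature.NumberTheory.Automorphic (siegelUpperHalfSpace)
open Literature.Geometry.Kaehler Literature.Geometry.Kaehler.ComplexTorus

variable {g : ℕ}

/-! ## §0 Casting -/

/-- `(P Q)_R = P_R Q_R`. [folklore] -/
private theorem map_intCast_mul_g50c {R : Type*} [NonAssocRing R] {m n o : Type*} [Fintype n]
    (P : Matrix m n ℤ) (Q : Matrix n o ℤ) :
    (P * Q).map (Int.cast : ℤ → R) = P.map (Int.cast : ℤ → R) * Q.map (Int.cast : ℤ → R) := by
  ext i j
  simp [Matrix.mul_apply]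

/-- `(c • P)_ℂ = c • P_ℂ`. [folklore] -/
private theorem map_intCast_zsmul_g50c {m n : Type*} (c : ℤ) (P : Matrix m n ℤ) :
    (c • P).map (Int.cast : ℤ → ℂ) = (c : ℂ) • P.map (Int.cast : ℤ → ℂ) := by
  ext i j
  simp [Matrix.map_apply]

/-- The integer diagonal `Δ = diag(δ)` cast to `ℂ` is the complex diagonal of `δ`. [folklore] -/
private theorem diagonal_natCast_map_g50c (δ : Fin g → ℕ) :
    (Matrix.diagonal fun i ↦ (δ i : ℤ)).map (Int.cast : ℤ → ℂ) = Matrix.diagonal fun i ↦ (δ i : ℂ) := by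
  rw [Matrix.diagonal_map (Int.cast_zero)]
  simp

/-! ## §1 `End(X^δ_Z)` in blocks for the period matrix `(Z, Δ)`: «`A(Z, D) = (Z, D)R`» -/

section Blocks

variable {δ : Fin g → ℕ} (hδ : ∀ i, 0 < δ i) {Z : Matrix (Fin g) (Fin g) ℂ} (hZ : Z ∈ siegelUpperHalfSpace g)

omit hδ hZ in
/-- **«`A(Z, D) = (Z, D)R`» in four blocks**: `A (Z, Δ) = (Z′, Δ)(α β; γ δ′)` iff `AZ = Z′α + Δγ` and
`AΔ = Z′β + Δδ′` (columns `Z`-part and `Δ`-part; g48-#2's `mul_siegelPeriodMatrix_eq_mul_fromBlocks_iff₄`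
is the principal case `Δ = 1`). [cite: Lange2023AbelianVarietiesComplex, §3.1.2 Prop. 3.1.4 and (1.2), pp. 158–160] -/
theorem mul_siegelPeriodMatrix_eq_mul_fromBlocks_iff_of_type (α β γ δ' : Matrix (Fin g) (Fin g) ℤ)
    (A Z Z' : Matrix (Fin g) (Fin g) ℂ) :
    A * siegelPeriodMatrix δ Z = siegelPeriodMatrix δ Z' * (Matrix.fromBlocks α β γ δ').map (Int.cast : ℤ → ℂ) ↔
      A * Z = Z' * α.map (Int.cast : ℤ → ℂ) + (Matrix.diagonal fun i ↦ (δ i : ℂ)) * γ.map (Int.cast : ℤ → ℂ) ∧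
        A * (Matrix.diagonal fun i ↦ (δ i : ℂ)) =
          Z' * β.map (Int.cast : ℤ → ℂ) + (Matrix.diagonal fun i ↦ (δ i : ℂ)) * δ'.map (Int.cast : ℤ → ℂ) := by
  rw [siegelPeriodMatrix, siegelPeriodMatrix, Matrix.fromBlocks_map, Matrix.mul_fromCols,
    Matrix.fromCols_mul_fromBlocks, Matrix.fromCols_ext_iff]

/-- **The period relations of a holomorphic endomorphism of `X^δ_Z`.**  If an integer matrix
`R = (α β; γ δ′)` of the lattice of `X^δ_Z = ℂ^g/(Z, Δ)ℤ^{2g}` commutes with the complex structure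
(`R_ℝ J = J R_ℝ`, i.e. `ρ(R)` is holomorphic), then its analytic representation `A` satisfies
**`AZ = Zα + Δγ`** and **`AΔ = Zβ + Δδ′`** (Lange (1.2) `ρ_a(f)(Z, D) = (Z, D)ρ_r(f)`).
[cite: Lange2023AbelianVarietiesComplex, §1.1.2 Prop. 1.1.6 and (1.2), pp. 19–20] -/
theorem exists_blocks_rel_of_mulVec_latticeJ_of_type {R : Matrix (Fin g ⊕ Fin g) (Fin g ⊕ Fin g) ℤ}
    (hR : ∀ x, (R.map (Int.cast : ℤ → ℝ)) *ᵥ latticeJ (siegelPeriodEquiv hδ hZ) x =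
      latticeJ (siegelPeriodEquiv hδ hZ) ((R.map (Int.cast : ℤ → ℝ)) *ᵥ x)) :
    ∃ A : Matrix (Fin g) (Fin g) ℂ,
      A * Z = Z * R.toBlocks₁₁.map (Int.cast : ℤ → ℂ) +
          (Matrix.diagonal fun i ↦ (δ i : ℂ)) * R.toBlocks₂₁.map (Int.cast : ℤ → ℂ) ∧
        A * (Matrix.diagonal fun i ↦ (δ i : ℂ)) =
          Z * R.toBlocks₁₂.map (Int.cast : ℤ → ℂ) +
            (Matrix.diagonal fun i ↦ (δ i : ℂ)) * R.toBlocks₂₂.map (Int.cast : ℤ → ℂ) := by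
  set Φ := siegelPeriodEquiv hδ hZ with hΦ
  have hI : ∀ u, realRep Φ Φ R (Complex.I • u) = Complex.I • realRep Φ Φ R u := fun u ↦ by
    obtain ⟨x, rfl⟩ := Φ.surjective u
    rw [← apply_latticeJ, realRep_apply, realRep_apply, hR, apply_latticeJ]
  set C : (Fin g → ℂ) →L[ℂ] (Fin g → ℂ) := toComplexLinear (realRep Φ Φ R) hI with hC
  have hrel : LinearMap.toMatrix' (C : (Fin g → ℂ) →ₗ[ℂ] (Fin g → ℂ)) * siegelPeriodMatrix δ Z =
      siegelPeriodMatrix δ Z * R.map (Int.cast : ℤ → ℂ) :=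
    (rel_iff_matrix δ Z Z _ R).1 fun v ↦ by
      rw [ContinuousLinearMap.coe_coe, hC, toComplexLinear_apply, ← siegelPeriodEquiv_apply hδ hZ,
        ← siegelPeriodEquiv_apply hδ hZ, realRep_apply]
  rw [← Matrix.fromBlocks_toBlocks R] at hrel
  obtain ⟨h1, h2⟩ := (mul_siegelPeriodMatrix_eq_mul_fromBlocks_iff_of_type _ _ _ _ _ Z Z).1 hrel
  exact ⟨_, h1, h2⟩

/-- **Conversely, the period relations suffice**: if `AZ = Zα + Δγ` and `AΔ = Zβ + Δδ′` for the blocks of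
an integral `R` and some complex `A`, then `R` commutes with the complex structure of `X^δ_Z` (`ρ(R)` is a
holomorphic endomorphism with analytic representation `A`). [cite: Lange2023AbelianVarietiesComplex, §1.1.2 Prop. 1.1.6 and (1.2), pp. 19–20] -/
theorem mulVec_latticeJ_comm_of_blocks_rel_of_type (R : Matrix (Fin g ⊕ Fin g) (Fin g ⊕ Fin g) ℤ)
    (A : Matrix (Fin g) (Fin g) ℂ)
    (h1 : A * Z = Z * R.toBlocks₁₁.map (Int.cast : ℤ → ℂ) +
      (Matrix.diagonal fun i ↦ (δ i : ℂ)) * R.toBlocks₂₁.map (Int.cast : ℤ → ℂ))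
    (h2 : A * (Matrix.diagonal fun i ↦ (δ i : ℂ)) =
      Z * R.toBlocks₁₂.map (Int.cast : ℤ → ℂ) + (Matrix.diagonal fun i ↦ (δ i : ℂ)) * R.toBlocks₂₂.map (Int.cast : ℤ → ℂ)) :
    ∀ x, (R.map (Int.cast : ℤ → ℝ)) *ᵥ latticeJ (siegelPeriodEquiv hδ hZ) x =
      latticeJ (siegelPeriodEquiv hδ hZ) ((R.map (Int.cast : ℤ → ℝ)) *ᵥ x) := by
  intro x
  set C : (Fin g → ℂ) →ₗ[ℂ] (Fin g → ℂ) := Matrix.toLin' A with hC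
  have hmat : LinearMap.toMatrix' C * siegelPeriodMatrix δ Z = siegelPeriodMatrix δ Z * R.map (Int.cast : ℤ → ℂ) := by
    rw [hC, LinearMap.toMatrix'_toLin', ← Matrix.fromBlocks_toBlocks R]
    exact (mul_siegelPeriodMatrix_eq_mul_fromBlocks_iff_of_type _ _ _ _ A Z Z).2 ⟨h1, h2⟩
  have hCΦ : ∀ v, C (siegelPeriodEquiv hδ hZ v) =
      siegelPeriodEquiv hδ hZ ((R.map (Int.cast : ℤ → ℝ)) *ᵥ v) := fun v ↦ by
    rw [siegelPeriodEquiv_apply, siegelPeriodEquiv_apply]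
    exact (rel_iff_matrix δ Z Z C R).2 hmat v
  apply (siegelPeriodEquiv hδ hZ).injective
  rw [apply_latticeJ, ← hCΦ, ← hCΦ, apply_latticeJ, map_smul]

end Blocks

/-! ## §2 The type does not matter: `End(X_Z) = ℤ` for the principal torus forces `End(X^δ_Z) = ℤ` -/

section Transfer

variable {δ : Fin g → ℕ} (hδ : ∀ i, 0 < δ i) {Z : Matrix (Fin g) (Fin g) ℂ} (hZ : Z ∈ siegelUpperHalfSpace g)

omit hZ in
/-- `δ_i · (D/δ_i) = D` for `D = ∏ δ_i`. [folklore] -/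
private theorem mul_prod_div_g50c (i : Fin g) : δ i * ((∏ k, δ k) / δ i) = ∏ k, δ k :=
  Nat.mul_div_cancel' (Finset.dvd_prod_of_mem δ (Finset.mem_univ i))

omit hZ in
/-- `Δ Δᶜ = D · 1` over `ℂ`, `Δᶜ = diag(D/δ_i)`. [folklore] -/
private theorem diagonal_mul_codiagonal_g50c :
    (Matrix.diagonal fun i ↦ (δ i : ℂ)) * (Matrix.diagonal fun i ↦ ((((∏ k, δ k) / δ i : ℕ) : ℤ) : ℂ)) =
      ((∏ k, δ k : ℕ) : ℂ) • (1 : Matrix (Fin g) (Fin g) ℂ) := by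
  rw [Matrix.diagonal_mul_diagonal, Matrix.smul_one_eq_diagonal]
  congr 1
  funext i
  have h := mul_prod_div_g50c (δ := δ) i
  simp only [Int.cast_natCast]
  exact_mod_cast h

/-- **`End(X_Z) = ℤ ⟹ End(X^δ_Z) = ℤ` (same `Z ∈ 𝔥_g`, any type `δ`, `g ≥ 1`).**  If every integral matrix
holomorphic on the PRINCIPAL torus `X_Z = ℂ^g/(Z, 1)ℤ^{2g}` is scalar, then so is every integral matrix `R`
holomorphic on `X^δ_Z = ℂ^g/(Z, Δ)ℤ^{2g}`: with `A` the analytic representation of `R = (α β; γ δ′)`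
(`AZ = Zα + Δγ`, `AΔ = Zβ + Δδ′`, §1) and `D = ∏ δ_i`, `Δᶜ = DΔ⁻¹ ∈ M_g(ℤ)`, the integral matrix
`(Dα, βΔᶜ; DΔγ, Δδ′Δᶜ)` has analytic representation `DA` on `X_Z`
(`(ZβΔᶜ + Δδ′Δᶜ)Z = DAZ = Z(Dα) + DΔγ`), so it is `c·1`; then `βΔᶜ = 0`, `DΔγ = 0`, `Dα = c = Dδ′_{ii}`
force `β = γ = 0` and `α = δ′ = a·1`.  (Torus-level form of «`P_z` is generic iff `φ(z)` is generic»: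
genericity is a property of `z`, not of the type.) [cite: Shimura1972FieldOfRationality, §3 Thm. 2 proof («it is sufficient to find a generic `P_z` with `z` in `𝔜`»), pp. 176–177] [cite: Lange2023AbelianVarietiesComplex, §1.1.2 (1.2), p. 20] -/
theorem end_eq_smul_one_of_type_of_principal (hg : 0 < g)
    (hEnd : ∀ M : Matrix (Fin g ⊕ Fin g) (Fin g ⊕ Fin g) ℤ,
      (∀ x, (M.map (Int.cast : ℤ → ℝ)) *ᵥ
          latticeJ (siegelPeriodEquiv (δ := (1 : Fin g → ℕ)) (fun _ ↦ Nat.one_pos) hZ) x =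
        latticeJ (siegelPeriodEquiv (δ := (1 : Fin g → ℕ)) (fun _ ↦ Nat.one_pos) hZ)
          ((M.map (Int.cast : ℤ → ℝ)) *ᵥ x)) → ∃ c : ℤ, M = c • 1)
    (R : Matrix (Fin g ⊕ Fin g) (Fin g ⊕ Fin g) ℤ)
    (hR : ∀ x, (R.map (Int.cast : ℤ → ℝ)) *ᵥ latticeJ (siegelPeriodEquiv hδ hZ) x =
      latticeJ (siegelPeriodEquiv hδ hZ) ((R.map (Int.cast : ℤ → ℝ)) *ᵥ x)) :
    ∃ c : ℤ, R = c • 1 := by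
  obtain ⟨A, h1, h2⟩ := exists_blocks_rel_of_mulVec_latticeJ_of_type hδ hZ hR
  -- notation
  set α := R.toBlocks₁₁ with hα
  set β := R.toBlocks₁₂ with hβ
  set γ := R.toBlocks₂₁ with hγ
  set δ' := R.toBlocks₂₂ with hδ'
  set D : ℕ := ∏ k, δ k with hD
  have hDpos : 0 < D := Finset.prod_pos fun i _ ↦ hδ i
  have hDne : (D : ℤ) ≠ 0 := by exact_mod_cast hDpos.ne'
  set Δℤ : Matrix (Fin g) (Fin g) ℤ := Matrix.diagonal fun i ↦ (δ i : ℤ) with hΔℤ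
  set Δc : Matrix (Fin g) (Fin g) ℤ := Matrix.diagonal fun i ↦ ((D / δ i : ℕ) : ℤ) with hΔc
  have hΔℤC : Δℤ.map (Int.cast : ℤ → ℂ) = Matrix.diagonal fun i ↦ (δ i : ℂ) := diagonal_natCast_map_g50c δ
  have hΔcC : Δc.map (Int.cast : ℤ → ℂ) = Matrix.diagonal fun i ↦ ((((∏ k, δ k) / δ i : ℕ) : ℤ) : ℂ) := by
    rw [hΔc, Matrix.diagonal_map (Int.cast_zero)]
  -- the principal blocks `(Dα, βΔᶜ; DΔγ, Δδ′Δᶜ)` and their period relation with analytic representation `DA`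
  set α₁ : Matrix (Fin g) (Fin g) ℤ := (D : ℤ) • α with hα₁
  set β₁ : Matrix (Fin g) (Fin g) ℤ := β * Δc with hβ₁
  set γ₁ : Matrix (Fin g) (Fin g) ℤ := (D : ℤ) • (Δℤ * γ) with hγ₁
  set δ₁ : Matrix (Fin g) (Fin g) ℤ := Δℤ * δ' * Δc with hδ₁
  have hDA : Z * β₁.map (Int.cast : ℤ → ℂ) + δ₁.map (Int.cast : ℤ → ℂ) = (D : ℂ) • A := by
    rw [hβ₁, hδ₁, map_intCast_mul_g50c, map_intCast_mul_g50c, map_intCast_mul_g50c, hΔℤC, hΔcC,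
      ← Matrix.mul_assoc, ← Matrix.add_mul, ← h2, Matrix.mul_assoc, diagonal_mul_codiagonal_g50c,
      Matrix.mul_smul, Matrix.mul_one]
  have hrel : (Z * β₁.map (Int.cast : ℤ → ℂ) + δ₁.map (Int.cast : ℤ → ℂ)) * Z =
      Z * α₁.map (Int.cast : ℤ → ℂ) + γ₁.map (Int.cast : ℤ → ℂ) := by
    rw [hDA, Matrix.smul_mul, h1, hα₁, hγ₁, map_intCast_zsmul_g50c, map_intCast_zsmul_g50c,
      map_intCast_mul_g50c, hΔℤC, smul_add, Matrix.mul_smul, Int.cast_natCast]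
  -- so the principal matrix is holomorphic on `X_Z`, hence scalar
  have hcomm := mulVec_latticeJ_comm_of_blocks_rel (fun _ ↦ Nat.one_pos) hZ α₁ β₁ γ₁ δ₁ hrel
  obtain ⟨c, hc⟩ := hEnd _ hcomm
  rw [← Matrix.fromBlocks_one, Matrix.fromBlocks_smul, smul_zero, Matrix.fromBlocks_inj] at hc
  obtain ⟨hcα, hcβ, hcγ, hcδ⟩ := hc
  -- read off the blocks: `β = 0`
  have hβ0 : β = 0 := by
    ext i k
    have e := congrFun (congrFun hcβ i) k
    rw [hβ₁, hΔc, Matrix.mul_diagonal, Matrix.zero_apply] at e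
    have hk : (((D / δ k : ℕ) : ℤ)) ≠ 0 := by
      have := mul_prod_div_g50c (δ := δ) k
      have hpos : 0 < D / δ k := Nat.div_pos (Nat.le_of_dvd hDpos (Finset.dvd_prod_of_mem δ (Finset.mem_univ k))) (hδ k)
      exact_mod_cast hpos.ne'
    exact (mul_eq_zero.1 e).resolve_right hk
  -- `γ = 0`
  have hγ0 : γ = 0 := by
    ext i k
    have e := congrFun (congrFun hcγ i) k
    rw [hγ₁, Matrix.smul_apply, hΔℤ, Matrix.diagonal_mul, Matrix.zero_apply, smul_eq_mul] at e
    have hi : (δ i : ℤ) ≠ 0 := by exact_mod_cast (hδ i).ne'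
    rcases mul_eq_zero.1 e with h | h
    · exact absurd h hDne
    · exact (mul_eq_zero.1 h).resolve_left hi
  -- `Dα = c·1`: `c = D a` with `a = α₀₀`, and `α = a·1`
  set i₀ : Fin g := ⟨0, hg⟩ with hi₀
  set a : ℤ := α i₀ i₀ with ha
  have hca : c = (D : ℤ) * a := by
    have e := congrFun (congrFun hcα i₀) i₀
    rw [hα₁, Matrix.smul_apply, Matrix.smul_apply, Matrix.one_apply_eq, smul_eq_mul, smul_eq_mul, mul_one] at e
    exact e.symm
  have hαa : α = a • 1 := by
    ext i k
    have e := congrFun (congrFun hcα i) k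
    rw [hα₁, Matrix.smul_apply, Matrix.smul_apply, smul_eq_mul, smul_eq_mul, hca, mul_assoc] at e
    rw [Matrix.smul_apply, smul_eq_mul]
    exact mul_left_cancel₀ hDne e
  -- `Δδ′Δᶜ = c·1`: `δ′ = a·1`
  have hδa : δ' = a • 1 := by
    ext i k
    have e := congrFun (congrFun hcδ i) k
    rw [hδ₁, hΔc, Matrix.mul_diagonal, hΔℤ, Matrix.diagonal_mul, Matrix.smul_apply, smul_eq_mul, hca] at e
    rw [Matrix.smul_apply, smul_eq_mul]
    by_cases hik : i = k
    · subst hik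
      rw [Matrix.one_apply_eq, mul_one] at e ⊢
      -- `δ_i δ′_ii (D/δ_i) = D a`
      have hDi : (δ i : ℤ) * ((D / δ i : ℕ) : ℤ) = D := by exact_mod_cast mul_prod_div_g50c (δ := δ) i
      have e' : (D : ℤ) * δ' i i = (D : ℤ) * a := by
        rw [← e, ← hDi]
        ring
      exact mul_left_cancel₀ hDne e'
    · rw [Matrix.one_apply_ne hik, mul_zero] at e ⊢
      have hi : (δ i : ℤ) ≠ 0 := by exact_mod_cast (hδ i).ne'
      have hk : (((D / δ k : ℕ) : ℤ)) ≠ 0 := by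
        have hpos : 0 < D / δ k := Nat.div_pos (Nat.le_of_dvd hDpos (Finset.dvd_prod_of_mem δ (Finset.mem_univ k))) (hδ k)
        exact_mod_cast hpos.ne'
      rcases mul_eq_zero.1 e with h | h
      · exact (mul_eq_zero.1 h).resolve_left hi
      · exact absurd h hk
  refine ⟨a, ?_⟩
  rw [← Matrix.fromBlocks_toBlocks R, ← hα, ← hβ, ← hγ, ← hδ', hαa, hβ0, hγ0, hδa, ← Matrix.fromBlocks_one,
    Matrix.fromBlocks_smul, smul_zero]

end Transfer

/-! ## §3 THEOREM 2 under condition (5): the generic points of `𝔥_g ∩ 𝔜_j`, for every type `δ` with `jΔ = Δj` -/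

section TheoremTwo

variable {δ : Fin g → ℕ} (hδ : ∀ i, 0 < δ i) {j : Matrix (Fin g) (Fin g) ℤ} {Z : Matrix (Fin g) (Fin g) ℂ}
  (hZ𝔥 : Z ∈ siegelUpperHalfSpace g)

/-- **Thm. 2 under condition (5), pointwise.**  Let `δ` be a type and `j` integral with `j² = −1`,
`ᵗj j = 1`, `jΔ = Δj` (`g ≥ 1`), and let `Z ∈ 𝔥_g ∩ 𝔜_j` (`jZ = −Z̄j`) be a point whose PRINCIPAL torus has
`End(X_Z) = ℤ`.  Then for the polarized torus `P_z = (X^δ_Z, E^δ_Z)` OF TYPE `δ`: `P_z ≅ P_z^ρ =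
(X^δ_{−Z̄}, E^δ_{−Z̄})` by `λ = ρ(j ⊕ j)` with `λ^ρ ∘ λ = −1` (Prop. 10), `X^δ_Z ≅` every conjugate
presentation, `End(X^δ_Z) = ℤ` (§2), and `X^δ_Z` has NO real structure (Prop. 12) — «a generic `P_z` with
`z` in `𝔜`» has no model over its field of moduli. [cite: Shimura1972FieldOfRationality, §3 Prop. 10, Prop. 12 and Thm. 2, pp. 174–177] -/
theorem generic_of_type_of_end_eq_smul_one (hg : 0 < g) (hjj : j * j = -1) (hjT : jᵀ * j = 1)
    (hjZ : j.map (Int.cast : ℤ → ℂ) * Z = -Z.map conj * j.map (Int.cast : ℤ → ℂ))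
    (hjΔ : j * Matrix.diagonal (fun i ↦ (δ i : ℤ)) = Matrix.diagonal (fun i ↦ (δ i : ℤ)) * j)
    (hEnd : ∀ M : Matrix (Fin g ⊕ Fin g) (Fin g ⊕ Fin g) ℤ,
      (∀ x, (M.map (Int.cast : ℤ → ℝ)) *ᵥ
          latticeJ (siegelPeriodEquiv (δ := (1 : Fin g → ℕ)) (fun _ ↦ Nat.one_pos) hZ𝔥) x =
        latticeJ (siegelPeriodEquiv (δ := (1 : Fin g → ℕ)) (fun _ ↦ Nat.one_pos) hZ𝔥)
          ((M.map (Int.cast : ℤ → ℝ)) *ᵥ x)) → ∃ c : ℤ, M = c • 1) :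
    (∃ h : ComplexTorus (siegelPeriodEquiv hδ hZ𝔥) ≃+
        ComplexTorus (siegelPeriodEquiv hδ (neg_map_conj_mem_siegelUpperHalfSpace hZ𝔥)),
      IsPolarizedIso (siegelPeriodEquiv hδ hZ𝔥) (siegelForm hδ hZ𝔥)
        (siegelPeriodEquiv hδ (neg_map_conj_mem_siegelUpperHalfSpace hZ𝔥))
        (siegelForm hδ (neg_map_conj_mem_siegelUpperHalfSpace hZ𝔥)) h ∧
      ∀ t, mapMatrix (siegelPeriodEquiv hδ (neg_map_conj_mem_siegelUpperHalfSpace hZ𝔥)) (siegelPeriodEquiv hδ hZ𝔥)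
          (Matrix.fromBlocks j 0 0 j) (h t) = -t) ∧
    (∀ {Ec : Type} [NormedAddCommGroup Ec] [NormedSpace ℂ Ec] (Ψc : (Fin g ⊕ Fin g → ℝ) ≃L[ℝ] Ec),
        (∀ v, latticeJ Ψc v = -latticeJ (siegelPeriodEquiv hδ hZ𝔥) v) →
          IsIsomorphic (siegelPeriodEquiv hδ hZ𝔥) Ψc) ∧
    (∀ R : Matrix (Fin g ⊕ Fin g) (Fin g ⊕ Fin g) ℤ,
        (∀ x, (R.map (Int.cast : ℤ → ℝ)) *ᵥ latticeJ (siegelPeriodEquiv hδ hZ𝔥) x =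
          latticeJ (siegelPeriodEquiv hδ hZ𝔥) ((R.map (Int.cast : ℤ → ℝ)) *ᵥ x)) → ∃ c : ℤ, R = c • 1) ∧
    IsEmpty (RealStructure 𝓘(ℂ, Fin g → ℂ) (ComplexTorus (siegelPeriodEquiv hδ hZ𝔥))) := by
  have hEndδ : ∀ R : Matrix (Fin g ⊕ Fin g) (Fin g ⊕ Fin g) ℤ,
      (∀ x, (R.map (Int.cast : ℤ → ℝ)) *ᵥ latticeJ (siegelPeriodEquiv hδ hZ𝔥) x =
        latticeJ (siegelPeriodEquiv hδ hZ𝔥) ((R.map (Int.cast : ℤ → ℝ)) *ᵥ x)) → ∃ c : ℤ, R = c • 1 :=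
    end_eq_smul_one_of_type_of_principal hδ hZ𝔥 hg hEnd
  -- `End(X^δ_Z) = ℤ` ⟹ `End(X^δ_Z)^* = {±1}`
  have hUnits : ∀ P : Matrix (Fin g ⊕ Fin g) (Fin g ⊕ Fin g) ℤ,
      MDifferentiable 𝓘(ℂ, Fin g → ℂ) 𝓘(ℂ, Fin g → ℂ)
          (mapMatrix (siegelPeriodEquiv hδ hZ𝔥) (siegelPeriodEquiv hδ hZ𝔥) P) →
        (∃ Q : Matrix (Fin g ⊕ Fin g) (Fin g ⊕ Fin g) ℤ, P * Q = 1 ∧ Q * P = 1) → P = 1 ∨ P = -1 := by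
    intro P hP hPQ
    obtain ⟨Q, hPQ, -⟩ := hPQ
    obtain ⟨c, hc⟩ := hEndδ P (mulVec_latticeJ_comm_of_mdifferentiable hP)
    rw [hc, Matrix.smul_mul, Matrix.one_mul] at hPQ
    have hcq : c * Q (Sum.inl ⟨0, hg⟩) (Sum.inl ⟨0, hg⟩) = 1 := by
      have e := congrFun (congrFun hPQ (Sum.inl ⟨0, hg⟩)) (Sum.inl ⟨0, hg⟩)
      simpa using e
    rcases Int.eq_one_or_neg_one_of_mul_eq_one hcq with h1 | h1
    · left
      rw [hc, h1, one_smul]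
    · right
      rw [hc, h1, neg_smul, one_smul]
  obtain ⟨hpol, hiso, hempty⟩ :=
    exists_isPolarizedIso_conj_and_isEmpty_realStructure_of_comm hδ hZ𝔥 j hg hjj hjT hjZ hjΔ hUnits
  exact ⟨hpol, hiso, hEndδ, hempty⟩

/-- **THEOREM 2 UNDER CONDITION (5), BAIRE FORM.**  For a type `δ` and an integral `j` with `j² = −1`,
`ᵗj = −j`, `jΔ = Δj` (`g ≥ 1`), the points `Z` of `𝔥_g ∩ 𝔜_j` whose polarized torus `(X^δ_Z, E^δ_Z)` of type
`δ` is isomorphic to its conjugate `(X^δ_{−Z̄}, E^δ_{−Z̄})` (with `λ^ρ ∘ λ = −1`), is isomorphic to every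
conjugate presentation, has `End(X^δ_Z) = ℤ`, and admits NO real structure, form a RESIDUAL subset of
`𝔥_g ∩ 𝔜_j` («If the polarization satisfies the condition (5), then `P` has no model rational over its
field of moduli. … `𝔜` cannot be covered by `∪_{f ∈ S′} X_f`»). [cite: Shimura1972FieldOfRationality, §3 condition (5), Prop. 10–12 and Thm. 2, pp. 174–177] -/
theorem eventually_residual_locus_generic_of_type (hg : 0 < g) (hjj : j * j = -1) (hjT : jᵀ = -j)
    (hjΔ : j * Matrix.diagonal (fun i ↦ (δ i : ℤ)) = Matrix.diagonal (fun i ↦ (δ i : ℤ)) * j) :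
    ∀ᶠ z in residual ↥(siegelUpperHalfSpace g ∩
        {Z : Matrix (Fin g) (Fin g) ℂ | j.map (Int.cast : ℤ → ℂ) * Z = -Z.map conj * j.map (Int.cast : ℤ → ℂ)}),
      (∃ h : ComplexTorus (siegelPeriodEquiv hδ z.2.1) ≃+
          ComplexTorus (siegelPeriodEquiv hδ (neg_map_conj_mem_siegelUpperHalfSpace z.2.1)),
        IsPolarizedIso (siegelPeriodEquiv hδ z.2.1) (siegelForm hδ z.2.1)
          (siegelPeriodEquiv hδ (neg_map_conj_mem_siegelUpperHalfSpace z.2.1))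
          (siegelForm hδ (neg_map_conj_mem_siegelUpperHalfSpace z.2.1)) h ∧
        ∀ t, mapMatrix (siegelPeriodEquiv hδ (neg_map_conj_mem_siegelUpperHalfSpace z.2.1)) (siegelPeriodEquiv hδ z.2.1)
            (Matrix.fromBlocks j 0 0 j) (h t) = -t) ∧
      (∀ {Ec : Type} [NormedAddCommGroup Ec] [NormedSpace ℂ Ec] (Ψc : (Fin g ⊕ Fin g → ℝ) ≃L[ℝ] Ec),
          (∀ v, latticeJ Ψc v = -latticeJ (siegelPeriodEquiv hδ z.2.1) v) →
            IsIsomorphic (siegelPeriodEquiv hδ z.2.1) Ψc) ∧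
      (∀ R : Matrix (Fin g ⊕ Fin g) (Fin g ⊕ Fin g) ℤ,
          (∀ x, (R.map (Int.cast : ℤ → ℝ)) *ᵥ latticeJ (siegelPeriodEquiv hδ z.2.1) x =
            latticeJ (siegelPeriodEquiv hδ z.2.1) ((R.map (Int.cast : ℤ → ℝ)) *ᵥ x)) → ∃ c : ℤ, R = c • 1) ∧
      IsEmpty (RealStructure 𝓘(ℂ, Fin g → ℂ) (ComplexTorus (siegelPeriodEquiv hδ z.2.1))) :=
  (eventually_residual_locus_generic (fun _ ↦ Nat.one_pos) hg hjj hjT).mono fun z hz ↦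
    generic_of_type_of_end_eq_smul_one hδ z.2.1 hg hjj (transpose_mul_self_eq_one_of_locusJ hjj hjT) z.2.2 hjΔ
      hz.2.2.1

/-- **Thm. 2 under condition (5), density form**: the type-`δ` generic points are dense in `𝔥_g ∩ 𝔜_j`.
[cite: Shimura1972FieldOfRationality, §3 Prop. 11 and Thm. 2, pp. 175–177] -/
theorem dense_locus_generic_of_type (hg : 0 < g) (hjj : j * j = -1) (hjT : jᵀ = -j)
    (hjΔ : j * Matrix.diagonal (fun i ↦ (δ i : ℤ)) = Matrix.diagonal (fun i ↦ (δ i : ℤ)) * j) :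
    Dense {z : ↥(siegelUpperHalfSpace g ∩
        {Z : Matrix (Fin g) (Fin g) ℂ | j.map (Int.cast : ℤ → ℂ) * Z = -Z.map conj * j.map (Int.cast : ℤ → ℂ)}) |
      (∃ h : ComplexTorus (siegelPeriodEquiv hδ z.2.1) ≃+
          ComplexTorus (siegelPeriodEquiv hδ (neg_map_conj_mem_siegelUpperHalfSpace z.2.1)),
        IsPolarizedIso (siegelPeriodEquiv hδ z.2.1) (siegelForm hδ z.2.1)
          (siegelPeriodEquiv hδ (neg_map_conj_mem_siegelUpperHalfSpace z.2.1))
          (siegelForm hδ (neg_map_conj_mem_siegelUpperHalfSpace z.2.1)) h ∧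
        ∀ t, mapMatrix (siegelPeriodEquiv hδ (neg_map_conj_mem_siegelUpperHalfSpace z.2.1)) (siegelPeriodEquiv hδ z.2.1)
            (Matrix.fromBlocks j 0 0 j) (h t) = -t) ∧
      (∀ {Ec : Type} [NormedAddCommGroup Ec] [NormedSpace ℂ Ec] (Ψc : (Fin g ⊕ Fin g → ℝ) ≃L[ℝ] Ec),
          (∀ v, latticeJ Ψc v = -latticeJ (siegelPeriodEquiv hδ z.2.1) v) →
            IsIsomorphic (siegelPeriodEquiv hδ z.2.1) Ψc) ∧
      (∀ R : Matrix (Fin g ⊕ Fin g) (Fin g ⊕ Fin g) ℤ,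
          (∀ x, (R.map (Int.cast : ℤ → ℝ)) *ᵥ latticeJ (siegelPeriodEquiv hδ z.2.1) x =
            latticeJ (siegelPeriodEquiv hδ z.2.1) ((R.map (Int.cast : ℤ → ℝ)) *ᵥ x)) → ∃ c : ℤ, R = c • 1) ∧
      IsEmpty (RealStructure 𝓘(ℂ, Fin g → ℂ) (ComplexTorus (siegelPeriodEquiv hδ z.2.1)))} := by
  haveI := baireSpace_locus j
  exact dense_of_mem_residual (eventually_residual_locus_generic_of_type hδ hg hjj hjT hjΔ)

/-- **«`𝔜` cannot be covered by `∪_{f ∈ S′} X_f`» in type `δ`**: for every countable family `X_n` of closed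
subsets of `𝔥_g ∩ 𝔜_j` with empty interiors there is a point `Z ∈ 𝔥_g ∩ 𝔜_j` outside all of them whose
polarized torus of type `δ` is isomorphic to its conjugate, has `End(X^δ_Z) = ℤ`, and admits no real
structure (`j² = −1`, `ᵗj = −j`, `jΔ = Δj`, `g ≥ 1`). [cite: Shimura1972FieldOfRationality, §3 Thm. 2 proof, p. 177] -/
theorem exists_locus_generic_not_mem_iUnion_of_type (hg : 0 < g) (hjj : j * j = -1) (hjT : jᵀ = -j)
    (hjΔ : j * Matrix.diagonal (fun i ↦ (δ i : ℤ)) = Matrix.diagonal (fun i ↦ (δ i : ℤ)) * j)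
    {ι : Type*} [Countable ι]
    (X : ι → Set ↥(siegelUpperHalfSpace g ∩
      {Z : Matrix (Fin g) (Fin g) ℂ | j.map (Int.cast : ℤ → ℂ) * Z = -Z.map conj * j.map (Int.cast : ℤ → ℂ)}))
    (hXc : ∀ n, IsClosed (X n)) (hXi : ∀ n, interior (X n) = ∅) :
    ∃ z : ↥(siegelUpperHalfSpace g ∩
        {Z : Matrix (Fin g) (Fin g) ℂ | j.map (Int.cast : ℤ → ℂ) * Z = -Z.map conj * j.map (Int.cast : ℤ → ℂ)}),
      (∀ n, z ∉ X n) ∧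
      (∃ h : ComplexTorus (siegelPeriodEquiv hδ z.2.1) ≃+
          ComplexTorus (siegelPeriodEquiv hδ (neg_map_conj_mem_siegelUpperHalfSpace z.2.1)),
        IsPolarizedIso (siegelPeriodEquiv hδ z.2.1) (siegelForm hδ z.2.1)
          (siegelPeriodEquiv hδ (neg_map_conj_mem_siegelUpperHalfSpace z.2.1))
          (siegelForm hδ (neg_map_conj_mem_siegelUpperHalfSpace z.2.1)) h) ∧
      (∀ R : Matrix (Fin g ⊕ Fin g) (Fin g ⊕ Fin g) ℤ,
          (∀ x, (R.map (Int.cast : ℤ → ℝ)) *ᵥ latticeJ (siegelPeriodEquiv hδ z.2.1) x =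
            latticeJ (siegelPeriodEquiv hδ z.2.1) ((R.map (Int.cast : ℤ → ℝ)) *ᵥ x)) → ∃ c : ℤ, R = c • 1) ∧
      IsEmpty (RealStructure 𝓘(ℂ, Fin g → ℂ) (ComplexTorus (siegelPeriodEquiv hδ z.2.1))) := by
  haveI := baireSpace_locus j
  haveI : Nonempty ↥(siegelUpperHalfSpace g ∩
      {Z : Matrix (Fin g) (Fin g) ℂ | j.map (Int.cast : ℤ → ℂ) * Z = -Z.map conj * j.map (Int.cast : ℤ → ℂ)}) :=
    (locus_nonempty j hjj hjT).to_subtype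
  have hX : (⋃ n, X n)ᶜ ∈ residual ↥(siegelUpperHalfSpace g ∩
      {Z : Matrix (Fin g) (Fin g) ℂ | j.map (Int.cast : ℤ → ℂ) * Z = -Z.map conj * j.map (Int.cast : ℤ → ℂ)}) := by
    rw [Set.compl_iUnion]
    exact countable_iInter_mem.2 fun n ↦
      residual_of_dense_open (hXc n).isOpen_compl (interior_eq_empty_iff_dense_compl.1 (hXi n))
  obtain ⟨z, ⟨⟨h, hh, -⟩, -, hend, hempty⟩, hz⟩ :=
    (dense_of_mem_residual (Filter.inter_mem (eventually_residual_locus_generic_of_type hδ hg hjj hjT hjΔ) hX)).nonempty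
  exact ⟨z, fun n hn ↦ hz (Set.mem_iUnion.2 ⟨n, hn⟩), ⟨h, hh⟩, hend, hempty⟩

end TheoremTwo

/-! ## §4 AS PRINTED: `δ = (d 0; 0 d)`, `j = j₀ = (0 −1_m; 1_m 0)`, `n = 2m` -/

section AsPrinted

variable {m : ℕ}

/-- **THEOREM 2 (condition (5)) AS PRINTED, in the torus model.**  Let `n = 2m ≥ 2`, `d` a diagonal of size
`m` (positive entries), `δ = (d 0; 0 d)`, `j = j₀ = (0 −1_m; 1_m 0)`.  Then there is a point `z ∈ 𝔜`
(`j₀z = −z^ρ j₀`) — indeed a dense, residual set of them — whose polarized torus `P_z = (X^δ_Z, E^δ_Z)`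
of type `δ` has `End = ℤ`, is isomorphic to `P_z^ρ = (X^δ_{−Z̄}, E^δ_{−Z̄})` by `λ` with `λ^ρ ∘ λ = −1`, and
admits NO real structure: «Let `P` be a generic polarized abelian variety of even dimension.  If the
polarization satisfies the condition (5), then `P` has no model rational over its field of moduli.»
[cite: Shimura1972FieldOfRationality, §3 condition (5), Prop. 10–12 and Thm. 2, pp. 174–177] -/
theorem exists_locus_generic_typeFive (hm : 0 < m) (d : Fin m → ℕ)
    (hd : ∀ i : Fin (m + m), 0 < (fun i : Fin (m + m) ↦ Sum.elim d d (finSumFinEquiv.symm i)) i) :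
    ∃ (Z : Matrix (Fin (m + m)) (Fin (m + m)) ℂ) (hZ : Z ∈ siegelUpperHalfSpace (m + m)),
      (Matrix.reindex finSumFinEquiv finSumFinEquiv
          (Matrix.fromBlocks (0 : Matrix (Fin m) (Fin m) ℤ) (-1 : Matrix (Fin m) (Fin m) ℤ)
            (1 : Matrix (Fin m) (Fin m) ℤ) (0 : Matrix (Fin m) (Fin m) ℤ))).map (Int.cast : ℤ → ℂ) * Z =
        -Z.map conj * (Matrix.reindex finSumFinEquiv finSumFinEquiv
          (Matrix.fromBlocks (0 : Matrix (Fin m) (Fin m) ℤ) (-1 : Matrix (Fin m) (Fin m) ℤ)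
            (1 : Matrix (Fin m) (Fin m) ℤ) (0 : Matrix (Fin m) (Fin m) ℤ))).map (Int.cast : ℤ → ℂ) ∧
      (∃ h : ComplexTorus (siegelPeriodEquiv hd hZ) ≃+
          ComplexTorus (siegelPeriodEquiv hd (neg_map_conj_mem_siegelUpperHalfSpace hZ)),
        IsPolarizedIso (siegelPeriodEquiv hd hZ) (siegelForm hd hZ)
          (siegelPeriodEquiv hd (neg_map_conj_mem_siegelUpperHalfSpace hZ))
          (siegelForm hd (neg_map_conj_mem_siegelUpperHalfSpace hZ)) h ∧
        ∀ t, mapMatrix (siegelPeriodEquiv hd (neg_map_conj_mem_siegelUpperHalfSpace hZ)) (siegelPeriodEquiv hd hZ)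
            (Matrix.fromBlocks
              (Matrix.reindex finSumFinEquiv finSumFinEquiv
                (Matrix.fromBlocks (0 : Matrix (Fin m) (Fin m) ℤ) (-1 : Matrix (Fin m) (Fin m) ℤ)
                  (1 : Matrix (Fin m) (Fin m) ℤ) (0 : Matrix (Fin m) (Fin m) ℤ))) 0 0
              (Matrix.reindex finSumFinEquiv finSumFinEquiv
                (Matrix.fromBlocks (0 : Matrix (Fin m) (Fin m) ℤ) (-1 : Matrix (Fin m) (Fin m) ℤ)
                  (1 : Matrix (Fin m) (Fin m) ℤ) (0 : Matrix (Fin m) (Fin m) ℤ)))) (h t) = -t) ∧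
      (∀ R : Matrix (Fin (m + m) ⊕ Fin (m + m)) (Fin (m + m) ⊕ Fin (m + m)) ℤ,
          (∀ x, (R.map (Int.cast : ℤ → ℝ)) *ᵥ latticeJ (siegelPeriodEquiv hd hZ) x =
            latticeJ (siegelPeriodEquiv hd hZ) ((R.map (Int.cast : ℤ → ℝ)) *ᵥ x)) → ∃ c : ℤ, R = c • 1) ∧
      IsEmpty (RealStructure 𝓘(ℂ, Fin (m + m) → ℂ) (ComplexTorus (siegelPeriodEquiv hd hZ))) := by
  obtain ⟨hjj, hjT, -⟩ := locusJ_mul_self_and_transpose (m := m) rfl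
  have hg : 0 < m + m := by omega
  haveI := baireSpace_locus (g := m + m) (Matrix.reindex finSumFinEquiv finSumFinEquiv
    (Matrix.fromBlocks (0 : Matrix (Fin m) (Fin m) ℤ) (-1 : Matrix (Fin m) (Fin m) ℤ)
      (1 : Matrix (Fin m) (Fin m) ℤ) (0 : Matrix (Fin m) (Fin m) ℤ)))
  haveI := (locus_nonempty _ hjj hjT).to_subtype
  obtain ⟨z, hpol, -, hend, hempty⟩ :=
    (dense_locus_generic_of_type hd hg hjj hjT (blockJ_mul_blockDiagonal_comm d)).nonempty
  exact ⟨z.1, z.2.1, z.2.2, hpol, hend, hempty⟩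

end AsPrinted

end SiegelModuli

end Literature.AlgebraicGeometry.ModuliOfAbelianVarieties
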